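import Summits.KontsevichZagierPeriods.KontsevichZagierPeriods.Theses.HermiteRigidity
import Literature.NumberTheory.Transcendental.SemialgebraicMapsProofs

/-!
# `GenusTwoCycleTransfer` (crux stmt-KontsevichZagierPeriods-3408), line `separating-pencil-trace`

Skeleton of the line lead. On the genus-2 curve `y² = f(x) = x(x−1)(x−2)(x−3)(x−5)` the three
integrals `∫_{J} dx/√f`, `J = (0,1), (2,3), (5,∞)`, are pushed forward to the half-line `(0,∞)` by
the explicit strictly increasing `ℚ`-semialgebraic bijections
`Λ(x) = √(N(x)/D(x))`, `N = x(x−2)(x−5)`, `D = (x−1)(x−3)` (one `KZ.changeOfVariablesRel` instance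
each, Kontsevich–Zagier's rule (2)); the fibre of `Λ` over `λ > 0` is cut out by the interlacing
cubic pencil `c_λ = N − λ²D`, the push-forward integrands are `ψᵢ(λ) = 2/|c_λ′(Xᵢ(λ))|`, and
`ψ₁ − ψ₂ + ψ₃ ≡ 0` is partial fractions for a monic cubic with three simple roots (the trace of
`dx/y` under the separating `g¹₃`), so one `KZ.integrandAddRel` instance closes the derivation.

Stubs (registered, generic): `stub_semialgebraicInvFunOn` (the inverse of an injective
semialgebraic map is semialgebraic on the image) and `stub_pushforwardDimOne` (the 1-dimensional
rule-2 push-forward). Everything pencil-specific is proved here; `GenusTwoCycleTransfer_of`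
concludes the crux by name.

References: M. Kontsevich, D. Zagier, *Periods* (2001), §1.2 rules (1), (2); J. Bochnak,
M. Coste, M.-F. Roy, *Real Algebraic Geometry* (1998), §2.2.
-/

noncomputable section

open Set MeasureTheory MvPolynomial
open Literature.NumberTheory.Transcendental Literature.ModelTheory.ExponentialFields

namespace Summit.KontsevichZagierPeriods.HermiteRigidity.GenusTwoCycleTransfer

/-! ### Registered stubs -/

/-- **Stub** `stub_semialgebraicInvFunOn`: the inverse (`Function.invFunOn`) of a `ℚ`-semialgebraic
map `Φ` injective on `σ` is a `ℚ`-semialgebraic map on the image `Φ '' σ` (its graph is the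
coordinate swap of the graph of `Φ`). [cite: BochnakCosteRoy1998, §2.2] -/
theorem stub_semialgebraicInvFunOn {m n : ℕ} {σ : Set (Fin m → ℝ)} {Φ : (Fin m → ℝ) → (Fin n → ℝ)} (hΦ : IsSemialgebraicMapOn ℚ σ Φ) (hinj : InjOn Φ σ) : IsSemialgebraicMapOn ℚ (Φ '' σ) (Function.invFunOn Φ σ) := by
  sorry

/-- **Stub** `stub_pushforwardDimOne`: the one-dimensional rule-2 push-forward. If `φ` is
`ℚ`-semialgebraic on the domain of `r : KZ.IntegralRep 1` with a `ℚ`-semialgebraic nowhere-zero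
derivative `φ'` there and a `ℚ`-semialgebraic left inverse `G` on the image, then
`[φ(σ), (f/|φ'|) ∘ G]` is an integral representation and `[r] − [it] ∈ KZ.changeOfVariablesRel`.
[cite: KontsevichZagier2001, §1.2 rule (2)] -/
theorem stub_pushforwardDimOne (r : KZ.IntegralRep 1) (φ φ' : ℝ → ℝ) (G : (Fin 1 → ℝ) → (Fin 1 → ℝ)) (hφ : IsSemialgebraicFunOn ℚ r.domain (fun p => φ (p 0))) (hφ' : IsSemialgebraicFunOn ℚ r.domain (fun p => φ' (p 0))) (hder : ∀ p ∈ r.domain, HasDerivAt φ (φ' (p 0)) (p 0)) (hne : ∀ p ∈ r.domain, φ' (p 0) ≠ 0) (hG : IsSemialgebraicMapOn ℚ ((fun p : Fin 1 → ℝ => fun _ : Fin 1 => φ (p 0)) '' r.domain) G) (hGφ : ∀ p ∈ r.domain, G (fun _ => φ (p 0)) = p) : ∃ s : KZ.IntegralRep 1, s.domain = (fun p : Fin 1 → ℝ => fun _ : Fin 1 => φ (p 0)) '' r.domain ∧ (∀ p ∈ r.domain, s.integrand (fun _ => φ (p 0)) = r.integrand p / |φ' (p 0)|) ∧ KZ.of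 r - KZ.of s ∈ KZ.changeOfVariablesRel := by
  sorry

/-! ### The pencil: notation

`𝐍⟮x⟯ = x(x−2)(x−5)`, `𝐃⟮x⟯ = (x−1)(x−3)`, `𝐟⟮x⟯ = 𝐍·𝐃`, `𝐖 = 𝐍′𝐃 − 𝐍𝐃′` (in sum-of-squares
form), the pencil `𝐜⟮l, x⟯ = 𝐍 − l²𝐃` and its `x`-derivative `𝐝𝐜`, the map `𝚽 = √(𝐍/𝐃)` and its
derivative `𝚽'`. These are notations, not definitions. -/

local notation "𝐍⟮" x "⟯" => (x * (x - 2) * (x - 5) : ℝ)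
local notation "𝐃⟮" x "⟯" => ((x - 1) * (x - 3) : ℝ)
local notation "𝐖⟮" x "⟯" => ((x ^ 2 - 4 * x + 5) ^ 2 + (x - 1) ^ 2 + 4 : ℝ)
local notation "𝐟⟮" x "⟯" => (x * (x - 1) * (x - 2) * (x - 3) * (x - 5) : ℝ)
local notation "𝐜⟮" l ", " x "⟯" => (x * (x - 2) * (x - 5) - l ^ 2 * ((x - 1) * (x - 3)) : ℝ)
local notation "𝐝𝐜⟮" l ", " x "⟯" => (3 * x ^ 2 - 14 * x + 10 - l ^ 2 * (2 * x - 4) : ℝ)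
local notation "𝚽⟮" x "⟯" => Real.sqrt (x * (x - 2) * (x - 5) / ((x - 1) * (x - 3)))
local notation "𝚽'⟮" x "⟯" =>
  (((x ^ 2 - 4 * x + 5) ^ 2 + (x - 1) ^ 2 + 4) / (2 * (x * (x - 2) * (x - 5)) * ((x - 1) * (x - 3))) *
    Real.sqrt (x * (x - 2) * (x - 5) / ((x - 1) * (x - 3))) : ℝ)

/-! ### Pencil algebra -/

/-- `𝐖 = (x²−4x+5)² + (x−1)² + 4 > 0`. [folklore] -/
theorem W_pos (x : ℝ) : 0 < 𝐖⟮x⟯ := by positivity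

/-- `f = N · D`. [folklore] -/
theorem f_eq (x : ℝ) : 𝐟⟮x⟯ = 𝐍⟮x⟯ * 𝐃⟮x⟯ := by ring

/-- `𝐖 = N′D − ND′`. [folklore] -/
theorem W_eq (x : ℝ) : 𝐖⟮x⟯ = (3 * x ^ 2 - 14 * x + 10) * 𝐃⟮x⟯ - 𝐍⟮x⟯ * (2 * x - 4) := by ring

/-- At a root of the pencil cubic, `D · ∂ₓc = 𝐖`. [folklore] -/
theorem dc_eq (l x : ℝ) (h : 𝐜⟮l, x⟯ = 0) : 𝐃⟮x⟯ * 𝐝𝐜⟮l, x⟯ = 𝐖⟮x⟯ := by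
  have : x * (x - 2) * (x - 5) = l ^ 2 * ((x - 1) * (x - 3)) := by linarith
  nlinarith [this]

/-- Vieta for a monic cubic with three distinct roots: the two leading symmetric functions.
[folklore] -/
theorem cubic_vieta (a b d x₁ x₂ x₃ : ℝ) (h₁₂ : x₁ ≠ x₂) (h₁₃ : x₁ ≠ x₃) (h₂₃ : x₂ ≠ x₃)
    (h₁ : x₁ ^ 3 + a * x₁ ^ 2 + b * x₁ + d = 0) (h₂ : x₂ ^ 3 + a * x₂ ^ 2 + b * x₂ + d = 0)
    (h₃ : x₃ ^ 3 + a * x₃ ^ 2 + b * x₃ + d = 0) :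
    a = -(x₁ + x₂ + x₃) ∧ b = x₁ * x₂ + x₁ * x₃ + x₂ * x₃ := by
  have e12 : (x₂ - x₁) * ((x₂ ^ 2 + x₁ * x₂ + x₁ ^ 2) + a * (x₂ + x₁) + b) = 0 := by
    linear_combination h₂ - h₁
  have e13 : (x₃ - x₁) * ((x₃ ^ 2 + x₁ * x₃ + x₁ ^ 2) + a * (x₃ + x₁) + b) = 0 := by
    linear_combination h₃ - h₁
  have e12' : (x₂ ^ 2 + x₁ * x₂ + x₁ ^ 2) + a * (x₂ + x₁) + b = 0 :=
    (mul_eq_zero.mp e12).resolve_left (sub_ne_zero.mpr (Ne.symm h₁₂))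
  have e13' : (x₃ ^ 2 + x₁ * x₃ + x₁ ^ 2) + a * (x₃ + x₁) + b = 0 :=
    (mul_eq_zero.mp e13).resolve_left (sub_ne_zero.mpr (Ne.symm h₁₃))
  have e23 : (x₃ - x₂) * (x₃ + x₂ + x₁ + a) = 0 := by linear_combination e13' - e12'
  have ha : x₃ + x₂ + x₁ + a = 0 :=
    (mul_eq_zero.mp e23).resolve_left (sub_ne_zero.mpr (Ne.symm h₂₃))
  refine ⟨by linarith, ?_⟩
  have : a = -(x₁ + x₂ + x₃) := by linarith
  subst this
  linear_combination e12'

/-- The `x`-derivative of the pencil cubic at its three ordered roots (the cubic is monic, so it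
factors over its roots). [folklore] -/
theorem dc_at_roots (l x₁ x₂ x₃ : ℝ) (h₁₂ : x₁ < x₂) (h₂₃ : x₂ < x₃)
    (h₁ : 𝐜⟮l, x₁⟯ = 0) (h₂ : 𝐜⟮l, x₂⟯ = 0) (h₃ : 𝐜⟮l, x₃⟯ = 0) :
    𝐝𝐜⟮l, x₁⟯ = (x₁ - x₂) * (x₁ - x₃) ∧ 𝐝𝐜⟮l, x₂⟯ = (x₂ - x₁) * (x₂ - x₃) ∧
      𝐝𝐜⟮l, x₃⟯ = (x₃ - x₁) * (x₃ - x₂) := by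
  obtain ⟨ha, hb⟩ := cubic_vieta (-(7 + l ^ 2)) (10 + 4 * l ^ 2) (-3 * l ^ 2) x₁ x₂ x₃ h₁₂.ne
    (h₁₂.trans h₂₃).ne h₂₃.ne (by linear_combination h₁) (by linear_combination h₂)
    (by linear_combination h₃)
  exact ⟨by linear_combination (2 * x₁) * ha + hb, by linear_combination (2 * x₂) * ha + hb,
    by linear_combination (2 * x₃) * ha + hb⟩

/-- The trace identity behind the line: for `x₁ < x₂ < x₃`,
`2/|(x₁−x₂)(x₁−x₃)| − 2/|(x₂−x₁)(x₂−x₃)| + 2/|(x₃−x₁)(x₃−x₂)| = 0` (partial fractions).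
[folklore] -/
theorem trace_identity (x₁ x₂ x₃ : ℝ) (h₁₂ : x₁ < x₂) (h₂₃ : x₂ < x₃) :
    2 / |(x₂ - x₁) * (x₂ - x₃)| = 2 / |(x₁ - x₂) * (x₁ - x₃)| + 2 / |(x₃ - x₁) * (x₃ - x₂)| := by
  have h₁₃ := h₁₂.trans h₂₃
  rw [abs_of_neg (mul_neg_of_pos_of_neg (sub_pos.mpr h₁₂) (sub_neg.mpr h₂₃)),
    abs_of_pos (mul_pos_of_neg_of_neg (sub_neg.mpr h₁₂) (sub_neg.mpr h₁₃)),
    abs_of_pos (mul_pos (sub_pos.mpr h₁₃) (sub_pos.mpr h₂₃))]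
  have : x₁ - x₂ ≠ 0 := sub_ne_zero.mpr h₁₂.ne
  have : x₁ - x₃ ≠ 0 := sub_ne_zero.mpr h₁₃.ne
  have : x₂ - x₃ ≠ 0 := sub_ne_zero.mpr h₂₃.ne
  have : x₂ - x₁ ≠ 0 := sub_ne_zero.mpr h₁₂.ne'
  have : x₃ - x₁ ≠ 0 := sub_ne_zero.mpr h₁₃.ne'
  have : x₃ - x₂ ≠ 0 := sub_ne_zero.mpr h₂₃.ne'
  field_simp
  ring

/-- At a root `x` of `c_l` (`l > 0`, `D(x) ≠ 0`): `𝚽(x) = l`. [folklore] -/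
theorem phi_root (l x : ℝ) (hl : 0 < l) (hD : 𝐃⟮x⟯ ≠ 0) (hc : 𝐜⟮l, x⟯ = 0) : 𝚽⟮x⟯ = l := by
  have hN : 𝐍⟮x⟯ = l ^ 2 * 𝐃⟮x⟯ := by linarith
  rw [hN, mul_div_assoc, div_self hD, mul_one, Real.sqrt_sq hl.le]

/-- The rule-2 weight at a root `x` of `c_l`: `(1/√f(x)) / |𝚽′(x)| = 2/|∂ₓc_l(x)|`. [folklore] -/
theorem weight_root (l x : ℝ) (hl : 0 < l) (hD : 𝐃⟮x⟯ ≠ 0) (hc : 𝐜⟮l, x⟯ = 0)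
    (hdc : 𝐝𝐜⟮l, x⟯ ≠ 0) : 1 / Real.sqrt 𝐟⟮x⟯ / |𝚽'⟮x⟯| = 2 / |𝐝𝐜⟮l, x⟯| := by
  have hsρ : Real.sqrt (𝐍⟮x⟯ / 𝐃⟮x⟯) = l := phi_root l x hl hD hc
  have hW : 𝐖⟮x⟯ = 𝐃⟮x⟯ * 𝐝𝐜⟮l, x⟯ := (dc_eq l x hc).symm
  have hN : 𝐍⟮x⟯ = l ^ 2 * 𝐃⟮x⟯ := by linarith
  rw [f_eq, hsρ, hW, hN]
  set d : ℝ := 𝐃⟮x⟯ with hd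
  set e : ℝ := 𝐝𝐜⟮l, x⟯ with he
  clear_value d e
  have hl0 : l ≠ 0 := hl.ne'
  have h1 : Real.sqrt (l ^ 2 * d * d) = l * |d| := by
    rw [show l ^ 2 * d * d = (l * d) ^ 2 by ring, Real.sqrt_sq_eq_abs, abs_mul, abs_of_pos hl]
  have h2 : d * e / (2 * (l ^ 2 * d) * d) * l = e / (2 * l * d) := by
    field_simp
  have h3 : |e / (2 * l * d)| = |e| / (2 * l * |d|) := by
    rw [abs_div, abs_mul, abs_of_pos (by positivity : (0:ℝ) < 2 * l)]
  rw [h1, h2, h3]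
  have hda : |d| ≠ 0 := abs_ne_zero.mpr hD
  have hea : |e| ≠ 0 := abs_ne_zero.mpr hdc
  rw [div_div_eq_mul_div]
  congr 1
  field_simp

/-! ### Pencil analysis: signs, derivative, injectivity, interlacing -/

/-- Signs on `(0,1)`: `N > 0`, `D > 0`. [folklore] -/
theorem signs_Ioo01 (x : ℝ) (hx : x ∈ Ioo (0:ℝ) 1) : 0 < 𝐍⟮x⟯ ∧ 0 < 𝐃⟮x⟯ :=
  ⟨mul_pos_of_neg_of_neg (mul_neg_of_pos_of_neg hx.1 (by linarith [hx.2])) (by linarith [hx.2]),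
    mul_pos_of_neg_of_neg (by linarith [hx.2]) (by linarith [hx.2])⟩

/-- Signs on `(2,3)`: `N < 0`, `D < 0`. [folklore] -/
theorem signs_Ioo23 (x : ℝ) (hx : x ∈ Ioo (2:ℝ) 3) : 𝐍⟮x⟯ < 0 ∧ 𝐃⟮x⟯ < 0 :=
  ⟨mul_neg_of_pos_of_neg (mul_pos (by linarith [hx.1]) (by linarith [hx.1])) (by linarith [hx.2]),
    mul_neg_of_pos_of_neg (by linarith [hx.1]) (by linarith [hx.2])⟩

/-- Signs on `(5,∞)`: `N > 0`, `D > 0`. [folklore] -/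
theorem signs_Ioi5 (x : ℝ) (hx : x ∈ Ioi (5:ℝ)) : 0 < 𝐍⟮x⟯ ∧ 0 < 𝐃⟮x⟯ := by
  have hx' : 5 < x := hx
  exact ⟨mul_pos (mul_pos (by linarith) (by linarith)) (by linarith),
    mul_pos (by linarith) (by linarith)⟩

/-- Derivative of `ρ = N/D` where `D ≠ 0`: `ρ′ = 𝐖/D²`. [folklore] -/
theorem hasDerivAt_rho (x : ℝ) (hD : 𝐃⟮x⟯ ≠ 0) :
    HasDerivAt (fun y : ℝ => 𝐍⟮y⟯ / 𝐃⟮y⟯) (𝐖⟮x⟯ / 𝐃⟮x⟯ ^ 2) x := by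
  have hN : HasDerivAt (fun y : ℝ => 𝐍⟮y⟯) ((1 * (x - 2) + x * 1) * (x - 5) + x * (x - 2) * 1) x :=
    ((hasDerivAt_id x).mul ((hasDerivAt_id x).sub_const 2)).mul ((hasDerivAt_id x).sub_const 5)
  have hD' : HasDerivAt (fun y : ℝ => 𝐃⟮y⟯) (1 * (x - 3) + (x - 1) * 1) x :=
    ((hasDerivAt_id x).sub_const 1).mul ((hasDerivAt_id x).sub_const 3)
  refine (hN.div hD' hD).congr_deriv ?_
  rw [W_eq]
  ring

/-- Derivative of `𝚽 = √(N/D)` where `N, D ≠ 0`, `N/D > 0`: `𝚽′`. [folklore] -/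
theorem hasDerivAt_phi (x : ℝ) (hN : 𝐍⟮x⟯ ≠ 0) (hD : 𝐃⟮x⟯ ≠ 0) (hρ : 0 < 𝐍⟮x⟯ / 𝐃⟮x⟯) :
    HasDerivAt (fun y : ℝ => 𝚽⟮y⟯) (𝚽'⟮x⟯) x := by
  refine ((hasDerivAt_rho x hD).sqrt hρ.ne').congr_deriv ?_
  set n := 𝐍⟮x⟯ with hn
  set d := 𝐃⟮x⟯ with hd
  set w := 𝐖⟮x⟯ with hw
  have hs : Real.sqrt (n / d) * Real.sqrt (n / d) = n / d := Real.mul_self_sqrt hρ.le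
  have hs0 : Real.sqrt (n / d) ≠ 0 := (Real.sqrt_pos.mpr hρ).ne'
  rw [div_eq_iff (mul_ne_zero two_ne_zero hs0)]
  calc w / d ^ 2 = w / (2 * n * d) * 2 * (n / d) := by field_simp
    _ = w / (2 * n * d) * 2 * (Real.sqrt (n / d) * Real.sqrt (n / d)) := by rw [hs]
    _ = w / (2 * n * d) * Real.sqrt (n / d) * (2 * Real.sqrt (n / d)) := by ring

/-- `𝚽′ ≠ 0` where `N, D ≠ 0`, `N/D > 0`. [folklore] -/
theorem phi'_ne_zero (x : ℝ) (hN : 𝐍⟮x⟯ ≠ 0) (hD : 𝐃⟮x⟯ ≠ 0) (hρ : 0 < 𝐍⟮x⟯ / 𝐃⟮x⟯) :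
    𝚽'⟮x⟯ ≠ 0 :=
  mul_ne_zero (div_ne_zero (W_pos x).ne' (mul_ne_zero (mul_ne_zero two_ne_zero hN) hD))
    (Real.sqrt_pos.mpr hρ).ne'

/-- `𝚽` is injective on every open interval where `D ≠ 0` and `N/D > 0` (there `ρ′ = 𝐖/D² > 0`,
so `ρ`, hence `√ρ`, is strictly increasing). [folklore] -/
theorem phi_injOn {J : Set ℝ} (hJ : Convex ℝ J) (hJo : IsOpen J) (hD : ∀ x ∈ J, 𝐃⟮x⟯ ≠ 0)
    (hρ : ∀ x ∈ J, 0 < 𝐍⟮x⟯ / 𝐃⟮x⟯) : InjOn (fun x : ℝ => 𝚽⟮x⟯) J := by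
  have hcont : ContinuousOn (fun y : ℝ => 𝐍⟮y⟯ / 𝐃⟮y⟯) J :=
    fun x hx => ((hasDerivAt_rho x (hD x hx)).continuousAt).continuousWithinAt
  have hmono : StrictMonoOn (fun y : ℝ => 𝐍⟮y⟯ / 𝐃⟮y⟯) J := by
    refine strictMonoOn_of_deriv_pos hJ hcont fun x hx => ?_
    rw [hJo.interior_eq] at hx
    rw [(hasDerivAt_rho x (hD x hx)).deriv]
    exact div_pos (W_pos x) (pow_pos (abs_pos.mpr (hD x hx)) 2 |>.trans_eq (by rw [sq_abs]))
  intro x hx y hy hxy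
  by_contra hne
  rcases lt_or_gt_of_ne hne with h | h
  · exact absurd hxy (Real.sqrt_lt_sqrt (hρ x hx).le (hmono hx hy h)).ne
  · exact absurd hxy (Real.sqrt_lt_sqrt (hρ y hy).le (hmono hy hx h)).ne'

/-- Interlacing on `(0,1)`: `c_l(0) = −3l² < 0 < 4 = c_l(1)`. [folklore] -/
theorem exists_root_Ioo01 (l : ℝ) (hl : 0 < l) : ∃ x ∈ Ioo (0:ℝ) 1, 𝐜⟮l, x⟯ = 0 := by
  have hc : ContinuousOn (fun x : ℝ => 𝐜⟮l, x⟯) (Icc 0 1) := by fun_prop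
  have h0 : (0:ℝ) ∈ Ioo 𝐜⟮l, (0:ℝ)⟯ 𝐜⟮l, (1:ℝ)⟯ := by
    constructor <;> nlinarith [sq_pos_of_pos hl]
  exact intermediate_value_Ioo (show (0:ℝ) ≤ 1 by norm_num) hc h0

/-- Interlacing on `(2,3)`: `c_l(2) = l² > 0 > −6 = c_l(3)`. [folklore] -/
theorem exists_root_Ioo23 (l : ℝ) (hl : 0 < l) : ∃ x ∈ Ioo (2:ℝ) 3, 𝐜⟮l, x⟯ = 0 := by
  have hc : ContinuousOn (fun x : ℝ => 𝐜⟮l, x⟯) (Icc 2 3) := by fun_prop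
  have h0 : (0:ℝ) ∈ Ioo 𝐜⟮l, (3:ℝ)⟯ 𝐜⟮l, (2:ℝ)⟯ := by
    constructor <;> nlinarith [sq_pos_of_pos hl]
  exact intermediate_value_Ioo' (show (2:ℝ) ≤ 3 by norm_num) hc h0

/-- Interlacing on `(5,∞)`: `c_l(5) = −8l² < 0 < 70 + 35l² + 4l⁴ = c_l(7 + l²)`. [folklore] -/
theorem exists_root_Ioi5 (l : ℝ) (hl : 0 < l) : ∃ x ∈ Ioi (5:ℝ), 𝐜⟮l, x⟯ = 0 := by
  have hc : ContinuousOn (fun x : ℝ => 𝐜⟮l, x⟯) (Icc 5 (7 + l ^ 2)) := by fun_prop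
  have h7 : 𝐜⟮l, (7 + l ^ 2 : ℝ)⟯ = 70 + 35 * l ^ 2 + 4 * l ^ 4 := by ring
  have h0 : (0:ℝ) ∈ Ioo 𝐜⟮l, (5:ℝ)⟯ 𝐜⟮l, (7 + l ^ 2 : ℝ)⟯ := by
    refine ⟨by nlinarith [sq_pos_of_pos hl], ?_⟩
    rw [h7]
    positivity
  obtain ⟨x, hx, hx0⟩ := intermediate_value_Ioo (show (5:ℝ) ≤ 7 + l ^ 2 by nlinarith) hc h0
  exact ⟨x, hx.1, hx0⟩

/-! ### Semialgebraicity of `𝚽`, `𝚽′` -/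

/-- `p ↦ 𝚽(p 0)` is `ℚ`-semialgebraic on any `ℚ`-semialgebraic `σ ⊆ ℝ¹` where `D ≠ 0`.
[cite: BochnakCosteRoy1998, §2.2] -/
theorem phi_semialgebraic {σ : Set (Fin 1 → ℝ)} (hσ : IsSemialgebraic ℚ σ)
    (hD : ∀ p ∈ σ, 𝐃⟮p 0⟯ ≠ 0) : IsSemialgebraicFunOn ℚ σ (fun p => 𝚽⟮p 0⟯) := by
  have h1 := isSemialgebraicFunOn_aeval_div_aeval hσ
    (X 0 * (X 0 - 2) * (X 0 - 5) : MvPolynomial (Fin 1) ℚ) ((X 0 - 1) * (X 0 - 3))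
    (fun p hp => by simpa using hD p hp)
  have h2 : IsSemialgebraicFunOn ℚ σ (fun p => 𝐍⟮p 0⟯ / 𝐃⟮p 0⟯) :=
    h1.congr (fun p _ => by simp)
  exact IsSemialgebraicFunOn.sqrt_holds h2

/-- `p ↦ 𝚽′(p 0)` is `ℚ`-semialgebraic on any `ℚ`-semialgebraic `σ ⊆ ℝ¹` where `N, D ≠ 0`.
[cite: BochnakCosteRoy1998, Prop. 2.2.6] -/
theorem phi'_semialgebraic {σ : Set (Fin 1 → ℝ)} (hσ : IsSemialgebraic ℚ σ)
    (hN : ∀ p ∈ σ, 𝐍⟮p 0⟯ ≠ 0) (hD : ∀ p ∈ σ, 𝐃⟮p 0⟯ ≠ 0) :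
    IsSemialgebraicFunOn ℚ σ (fun p => 𝚽'⟮p 0⟯) := by
  have h1 := isSemialgebraicFunOn_aeval_div_aeval hσ
    ((X 0 ^ 2 - 4 * X 0 + 5) ^ 2 + (X 0 - 1) ^ 2 + 4 : MvPolynomial (Fin 1) ℚ)
    (2 * (X 0 * (X 0 - 2) * (X 0 - 5)) * ((X 0 - 1) * (X 0 - 3)))
    (fun p hp => by
      simp only [map_mul, map_sub, aeval_X, map_ofNat, map_one]
      exact mul_ne_zero (mul_ne_zero two_ne_zero (hN p hp)) (hD p hp))
  have h2 : IsSemialgebraicFunOn ℚ σ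
      (fun p => 𝐖⟮p 0⟯ / (2 * 𝐍⟮p 0⟯ * 𝐃⟮p 0⟯)) :=
    h1.congr (fun p _ => by simp)
  exact IsSemialgebraicFunOn.mul_holds h2 (phi_semialgebraic hσ hD)

/-! ### One oval: the rule-2 push-forward to `(0, ∞)` -/

/-- The image of `{p | p 0 ∈ J}` under `p ↦ (𝚽(p 0))` is the half-line `{q | 0 < q 0}` as soon as
`𝚽 > 0` on `J` and every level `l > 0` is attained on `J`. [folklore] -/
theorem image_phi_eq {J : Set ℝ} {σ : Set (Fin 1 → ℝ)} (hd : σ = {p | p 0 ∈ J})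
    (hpos : ∀ x ∈ J, 0 < 𝚽⟮x⟯) (hsurj : ∀ l, 0 < l → ∃ x ∈ J, 𝚽⟮x⟯ = l) :
    (fun p : Fin 1 → ℝ => fun _ : Fin 1 => 𝚽⟮p 0⟯) '' σ = {q | 0 < q 0} := by
  ext q
  constructor
  · rintro ⟨p, hp, rfl⟩
    rw [hd] at hp
    exact hpos _ hp
  · intro hq
    obtain ⟨x, hx, hxl⟩ := hsurj (q 0) hq
    refine ⟨fun _ => x, by rw [hd]; exact hx, ?_⟩
    funext i
    rw [Fin.fin_one_eq_zero i]
    exact hxl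

/-- **One oval.** For a representation `r = [{p | p 0 ∈ J}, 1/√f]` on an open interval `J` where
`N, D ≠ 0`, `N/D > 0`, `𝚽` is injective and every level `l > 0` of `𝚽` is cut out by a root of
`c_l` in `J`, the rule-2 push-forward along `𝚽` exists, has domain `(0, ∞)`, its integrand at
`l` is `2/|∂ₓc_l(x)|` at the root `x ∈ J`, and `[r] − [s] ∈ KZ.changeOfVariablesRel`.
[cite: KontsevichZagier2001, §1.2 rule (2)] -/
theorem oval_pushforward {J : Set ℝ} (hJ : Convex ℝ J) (hJo : IsOpen J) (r : KZ.IntegralRep 1)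
    (hd : r.domain = {p | p 0 ∈ J})
    (hi : EqOn r.integrand (fun p => 1 / Real.sqrt 𝐟⟮p 0⟯) r.domain)
    (hND : ∀ x ∈ J, 𝐍⟮x⟯ ≠ 0 ∧ 𝐃⟮x⟯ ≠ 0 ∧ 0 < 𝐍⟮x⟯ / 𝐃⟮x⟯)
    (hsurj : ∀ l, 0 < l → ∃ x ∈ J, 𝐜⟮l, x⟯ = 0) :
    ∃ s : KZ.IntegralRep 1, s.domain = {q | 0 < q 0} ∧
      (∀ l x, 0 < l → x ∈ J → 𝐜⟮l, x⟯ = 0 → 𝐝𝐜⟮l, x⟯ ≠ 0 →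
        s.integrand (fun _ => l) = 2 / |𝐝𝐜⟮l, x⟯|) ∧
      KZ.of r - KZ.of s ∈ KZ.changeOfVariablesRel := by
  have hσ : IsSemialgebraic ℚ r.domain := r.isSemialgebraic_domain
  have hmem : ∀ p : Fin 1 → ℝ, p ∈ r.domain ↔ p 0 ∈ J := fun p => by rw [hd]; rfl
  have hNσ : ∀ p ∈ r.domain, 𝐍⟮p 0⟯ ≠ 0 := fun p hp => (hND _ ((hmem p).1 hp)).1
  have hDσ : ∀ p ∈ r.domain, 𝐃⟮p 0⟯ ≠ 0 := fun p hp => (hND _ ((hmem p).1 hp)).2.1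
  have hφ : IsSemialgebraicFunOn ℚ r.domain (fun p => 𝚽⟮p 0⟯) := phi_semialgebraic hσ hDσ
  have hφ' : IsSemialgebraicFunOn ℚ r.domain (fun p => 𝚽'⟮p 0⟯) :=
    phi'_semialgebraic hσ hNσ hDσ
  have hder : ∀ p ∈ r.domain, HasDerivAt (fun y : ℝ => 𝚽⟮y⟯) (𝚽'⟮p 0⟯) (p 0) := fun p hp =>
    hasDerivAt_phi (p 0) (hNσ p hp) (hDσ p hp) (hND _ ((hmem p).1 hp)).2.2
  have hne : ∀ p ∈ r.domain, 𝚽'⟮p 0⟯ ≠ 0 := fun p hp =>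
    phi'_ne_zero (p 0) (hNσ p hp) (hDσ p hp) (hND _ ((hmem p).1 hp)).2.2
  have hinj : InjOn (fun x : ℝ => 𝚽⟮x⟯) J :=
    phi_injOn hJ hJo (fun x hx => (hND x hx).2.1) (fun x hx => (hND x hx).2.2)
  set Φ : (Fin 1 → ℝ) → (Fin 1 → ℝ) := fun p _ => 𝚽⟮p 0⟯ with hΦ_def
  have hΦsa : IsSemialgebraicMapOn ℚ r.domain Φ := IsSemialgebraicMapOn.of_forall hσ fun _ => hφ
  have hΦinj : InjOn Φ r.domain := by
    intro p hp p' hp' h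
    have h0 : 𝚽⟮p 0⟯ = 𝚽⟮p' 0⟯ := congrFun h 0
    have := hinj ((hmem p).1 hp) ((hmem p').1 hp') h0
    funext i
    rw [Fin.fin_one_eq_zero i]
    exact this
  have hG : IsSemialgebraicMapOn ℚ (Φ '' r.domain) (Function.invFunOn Φ r.domain) :=
    stub_semialgebraicInvFunOn hΦsa hΦinj
  have hGφ : ∀ p ∈ r.domain, Function.invFunOn Φ r.domain (Φ p) = p := fun p hp =>
    hΦinj.leftInvOn_invFunOn hp
  obtain ⟨s, hsd, hsi, hrel⟩ := stub_pushforwardDimOne r (fun y => 𝚽⟮y⟯) (fun y => 𝚽'⟮y⟯)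
    (Function.invFunOn Φ r.domain) hφ hφ' hder hne hG hGφ
  have hpos : ∀ x ∈ J, 0 < 𝚽⟮x⟯ := fun x hx => Real.sqrt_pos.mpr (hND x hx).2.2
  have hsurj' : ∀ l, 0 < l → ∃ x ∈ J, 𝚽⟮x⟯ = l := fun l hl => by
    obtain ⟨x, hx, hc⟩ := hsurj l hl
    exact ⟨x, hx, phi_root l x hl (hND x hx).2.1 hc⟩
  refine ⟨s, hsd.trans (image_phi_eq hd hpos hsurj'), fun l x hl hx hc hdc => ?_, hrel⟩
  have hp : (fun _ : Fin 1 => x) ∈ r.domain := (hmem _).2 hx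
  have h1 : s.integrand (fun _ => 𝚽⟮x⟯) = r.integrand (fun _ => x) / |𝚽'⟮x⟯| := hsi _ hp
  have h2 : (fun _ : Fin 1 => 𝚽⟮x⟯) = fun _ => l := funext fun _ => phi_root l x hl (hND x hx).2.1 hc
  rw [h2] at h1
  rw [h1, hi hp]
  exact weight_root l x hl (hND x hx).2.1 hc hdc

/-! ### Composition: the crux -/

/-- **The crux `GenusTwoCycleTransfer`** (stmt-KontsevichZagierPeriods-3408), from the two stubs:
three rule-2 push-forwards to `(0, ∞)` (`oval_pushforward` on `(0,1)`, `(2,3)`, `(5,∞)`) and one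
integrand-additivity move, the push-forward integrands satisfying `ψ₂ = ψ₁ + ψ₃` pointwise by the
trace identity at the three interlacing roots of the pencil cubic.
[cite: KontsevichZagier2001, §1.2 rules (1), (2)] -/
theorem GenusTwoCycleTransfer_of :
    Summit.KontsevichZagierPeriods.KontsevichZagierPeriods.Theses.HermiteRigidity.GenusTwoCycleTransfer := by
  unfold Summit.KontsevichZagierPeriods.KontsevichZagierPeriods.Theses.HermiteRigidity.GenusTwoCycleTransfer
  intro f r₁ r₂ r₃ h1d h1i h2d h2i h3d h3i
  -- the three ovals
  have hND₁ : ∀ x ∈ Ioo (0:ℝ) 1, 𝐍⟮x⟯ ≠ 0 ∧ 𝐃⟮x⟯ ≠ 0 ∧ 0 < 𝐍⟮x⟯ / 𝐃⟮x⟯ := fun x hx =>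
    ⟨(signs_Ioo01 x hx).1.ne', (signs_Ioo01 x hx).2.ne',
      div_pos (signs_Ioo01 x hx).1 (signs_Ioo01 x hx).2⟩
  have hND₂ : ∀ x ∈ Ioo (2:ℝ) 3, 𝐍⟮x⟯ ≠ 0 ∧ 𝐃⟮x⟯ ≠ 0 ∧ 0 < 𝐍⟮x⟯ / 𝐃⟮x⟯ := fun x hx =>
    ⟨(signs_Ioo23 x hx).1.ne, (signs_Ioo23 x hx).2.ne,
      div_pos_of_neg_of_neg (signs_Ioo23 x hx).1 (signs_Ioo23 x hx).2⟩
  have hND₃ : ∀ x ∈ Ioi (5:ℝ), 𝐍⟮x⟯ ≠ 0 ∧ 𝐃⟮x⟯ ≠ 0 ∧ 0 < 𝐍⟮x⟯ / 𝐃⟮x⟯ := fun x hx =>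
    ⟨(signs_Ioi5 x hx).1.ne', (signs_Ioi5 x hx).2.ne',
      div_pos (signs_Ioi5 x hx).1 (signs_Ioi5 x hx).2⟩
  obtain ⟨s₁, hs₁d, hs₁i, hs₁r⟩ := oval_pushforward (convex_Ioo 0 1) isOpen_Ioo r₁ h1d
    (by rw [h1d]; exact h1i) hND₁ exists_root_Ioo01
  obtain ⟨s₂, hs₂d, hs₂i, hs₂r⟩ := oval_pushforward (convex_Ioo 2 3) isOpen_Ioo r₂ h2d
    (by rw [h2d]; exact h2i) hND₂ exists_root_Ioo23
  obtain ⟨s₃, hs₃d, hs₃i, hs₃r⟩ := oval_pushforward (convex_Ioi 5) isOpen_Ioi r₃ h3d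
    (by rw [h3d]; exact h3i) hND₃ exists_root_Ioi5
  -- the trace identity: ψ₂ = ψ₁ + ψ₃ on (0, ∞)
  have key : EqOn s₂.integrand (s₁.integrand + s₃.integrand) s₂.domain := by
    intro q hq
    rw [hs₂d] at hq
    set l : ℝ := q 0 with hl_def
    have hl : 0 < l := hq
    obtain ⟨x₁, hx₁, hc₁⟩ := exists_root_Ioo01 l hl
    obtain ⟨x₂, hx₂, hc₂⟩ := exists_root_Ioo23 l hl
    obtain ⟨x₃, hx₃, hc₃⟩ := exists_root_Ioi5 l hl
    have h₁₂ : x₁ < x₂ := (hx₁.2.trans one_lt_two).trans hx₂.1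
    have hx₃' : 5 < x₃ := hx₃
    have h₂₃ : x₂ < x₃ := by linarith [hx₂.2]
    have h₁₃ : x₁ < x₃ := h₁₂.trans h₂₃
    obtain ⟨hd₁, hd₂, hd₃⟩ := dc_at_roots l x₁ x₂ x₃ h₁₂ h₂₃ hc₁ hc₂ hc₃
    have hne₁ : 𝐝𝐜⟮l, x₁⟯ ≠ 0 := by
      rw [hd₁]; exact mul_ne_zero (sub_ne_zero.mpr h₁₂.ne) (sub_ne_zero.mpr h₁₃.ne)
    have hne₂ : 𝐝𝐜⟮l, x₂⟯ ≠ 0 := by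
      rw [hd₂]; exact mul_ne_zero (sub_ne_zero.mpr h₁₂.ne') (sub_ne_zero.mpr h₂₃.ne)
    have hne₃ : 𝐝𝐜⟮l, x₃⟯ ≠ 0 := by
      rw [hd₃]; exact mul_ne_zero (sub_ne_zero.mpr h₁₃.ne') (sub_ne_zero.mpr h₂₃.ne')
    have hq' : q = fun _ => l := funext fun i => congrArg q (Fin.fin_one_eq_zero i)
    rw [hq', Pi.add_apply, hs₁i l x₁ hl hx₁ hc₁ hne₁, hs₂i l x₂ hl hx₂ hc₂ hne₂,
      hs₃i l x₃ hl hx₃ hc₃ hne₃, hd₁, hd₂, hd₃]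
    exact trace_identity x₁ x₂ x₃ h₁₂ h₂₃
  -- one rule-1b move
  have hadd : KZ.of s₂ - KZ.of s₁ - KZ.of s₃ ∈ KZ.integrandAddRel :=
    ⟨1, s₂, s₁, s₃, by rw [hs₁d, hs₂d], by rw [hs₃d, hs₂d], key, rfl⟩
  have h₁ := KZ.changeOfVariablesRel_subset_relations hs₁r
  have h₂ := KZ.changeOfVariablesRel_subset_relations hs₂r
  have h₃ := KZ.changeOfVariablesRel_subset_relations hs₃r
  have h₄ := KZ.integrandAddRel_subset_relations hadd
  have : KZ.of r₁ - KZ.of r₂ + KZ.of r₃ = (KZ.of r₁ - KZ.of s₁) - (KZ.of r₂ - KZ.of s₂) +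
      (KZ.of r₃ - KZ.of s₃) - (KZ.of s₂ - KZ.of s₁ - KZ.of s₃) := by abel
  rw [this]
  exact KZ.relations.sub_mem (KZ.relations.add_mem (KZ.relations.sub_mem h₁ h₂) h₃) h₄

end Summit.KontsevichZagierPeriods.HermiteRigidity.GenusTwoCycleTransfer

end
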